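import Summits.QuantumFields.YangMills.Theses.FemtoCutoffLadder
import Summits.QuantumFields.YangMills.Theorems.LuscherReductionOneSiteLevelsClosed
import Summits.QuantumFields.YangMills.Theorems.LuscherReductionRunningReductionBOHandoverLabels
import Summits.QuantumFields.YangMills.Theorems.FemtoTransferGapRungW1up

/-!
# Route `FemtoCutoffLadder` (QuantumFields / YangMills; rung R2b1 leaf `FemtoTransferGap.FemtoGapOfRecord`) — support item
# `OneSiteWindowAnchor` (stmt-QuantumFields-23508), PROVED: the one-site law in WINDOW form

Lead seat `ym-line-fcl-p1` (2026-08-27).  The PROVED one-site rung leaf `femtoGapOneSite_proof : FemtoGapOneSite`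
(`λ₁(β,1) ≤ e^{−(ε₁λ_b − Cλ_b²)} λ₀(β,1)` for `β ≥ β₀`, bare parameter `λ_b = (2/β)^{1/3}`; crux ONE of route `LuscherReduction`,
closed unconditionally in `LuscherReductionOneSiteLevelsClosed.lean`) is converted to the running parameter `Λ = luscherLambda β 1` of the
femto window: on the window at `L = 1` with depth `lam ≤ 1/2`,

* `bareLambda β ≤ Λ` (tree: `BOHandover.mul_bareLambda_le_luscherLambda`, the two-loop logarithm at `L = 1` is `−(b₁/b₀) log(β/(2b₀)) ≤ 0`);
* `Λ − λ_b ≤ K·Λ²` with the absolute constant `K = (b₁/b₀)(3 − log(2b₀))` (`luscherLambda_sub_bareLambda_le`): from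
  `Λ³ − λ_b³ = δ·Λ³·λ_b³`, `δ = β/2 − 1/ḡ²(β,1) = (b₁/b₀) log(β/(2b₀)) ≤ (b₁/b₀)(3 − log(2b₀))/λ_b` (`log(β/2) = 3 log(1/λ_b) ≤ 3/λ_b`),
  and `(Λ − λ_b)Λ² ≤ Λ³ − λ_b³`, `λ_b ≤ Λ ≤ 1`;
* hence `ε₁λ_b − Cλ_b² ≥ ε₁Λ − C'Λ²` with `C' = |ε₁|·K + |C|`, and `β ≥ β₀` deep in the window (`β ≥ 1/(4 lam³)`, tree
  `BOHandover.beta_ge_of_window` / `le_of_small_lam`).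

★ `oneSiteWindowAnchor_proof : Theses.FemtoCutoffLadder.OneSiteWindowAnchor` (the item, by name).

HONEST FRAMING: this is the `L = 1` three-matrix model only (the ANCHOR of the cutoff ladder); it says nothing about `L ≥ 2`, infinite
volume, a mass gap or the Clay problem; R2b1 is a RECORD rung.  No definitions, no named facts, no `sorry`.
-/

set_option autoImplicit false

noncomputable section

namespace Summit.QuantumFields.YangMills.Theorems.FemtoCutoffLadder

open Real
open Summit.QuantumFields.YangMills.Theorems.FemtoTransferGap
open Literature.Analysis.OperatorTheory.YMMatrixModel (luscherEps1)

/-- The absolute label constant `K = (b₁/b₀)(3 − log(2b₀)) > 0` of the one-site bare-vs-running comparison. [folklore] -/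
theorem anchorK_pos : 0 < (b1 / b0) * (3 - Real.log (2 * b0)) := by
  have hb0 : 0 < b0 := by unfold b0; positivity
  have hb1 : 0 < b1 := by unfold b1; positivity
  have hlog : Real.log (2 * b0) ≤ 0 :=
    Real.log_nonpos (by positivity) BOHandover.two_mul_b0_le_one
  exact mul_pos (div_pos hb1 hb0) (by linarith)

/-- On the one-site lattice with `β ≥ 1` and `Λ(β,1) > 0`: `λ_b ≤ Λ`. [cite: LuscherMunster1984, §2] -/
theorem bareLambda_le_luscherLambda_one {β : ℝ} (hβ : 1 ≤ β) (hl : 0 < luscherLambda β 1) :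
    bareLambda β ≤ luscherLambda β 1 := by
  simpa using BOHandover.mul_bareLambda_le_luscherLambda hβ 1 hl

/-- The two-loop deficit at `L = 1`: `β/2 − 1/ḡ²(β, 1) = (b₁/b₀) log(β/(2b₀))`, written as `(b₁/b₀)(log β − log(2b₀))`. [cite: LuscherMunster1984, §2] -/
theorem half_sub_invRunningCoupling_one {β : ℝ} (hβ : 0 < β) :
    β / 2 - invRunningCoupling β 1 = (b1 / b0) * (Real.log β - Real.log (2 * b0)) := by
  have hb0 : 0 < b0 := by unfold b0; positivity
  rw [BOHandover.invRunningCoupling_eq, Nat.cast_one, Real.log_one, mul_zero, sub_zero,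
    Real.log_div (by positivity) hβ.ne']
  ring

/-- `log β ≤ 3/λ_b` for `β > 0` (`β/2 = λ_b⁻³`, `log(β/2) = 3 log(1/λ_b) ≤ 3(1/λ_b − 1)`, `log 2 ≤ 1 ≤ 3`). [folklore] -/
theorem log_le_three_div_bareLambda {β : ℝ} (hβ : 0 < β) : Real.log β ≤ 3 / bareLambda β := by
  have hlb : 0 < bareLambda β := bareLambda_pos' hβ
  have hcube : β * bareLambda β ^ 3 = 2 := bareLambda_cube hβ
  have hβeq : β = 2 * (1 / bareLambda β) ^ 3 := by
    rw [div_pow, one_pow, mul_one_div, eq_div_iff (pow_pos hlb 3).ne']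
    linarith
  have hlog2 : Real.log β = Real.log 2 + 3 * Real.log (1 / bareLambda β) := by
    conv_lhs => rw [hβeq]
    rw [Real.log_mul (by norm_num) (by positivity), Real.log_pow]
    push_cast
    ring
  have hl1 : Real.log (1 / bareLambda β) ≤ 1 / bareLambda β - 1 := Real.log_le_sub_one_of_pos (by positivity)
  have hlog2le : Real.log (2 : ℝ) ≤ 1 := by
    have := Real.log_two_lt_d9; linarith
  rw [hlog2]
  have : 3 * Real.log (1 / bareLambda β) ≤ 3 / bareLambda β - 3 := by
    have := mul_le_mul_of_nonneg_left hl1 (by norm_num : (0 : ℝ) ≤ 3)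
    rw [mul_sub, mul_one, mul_one_div] at this
    exact this
  linarith

/-- **One-site label comparison**: on the weak-coupling branch (`β ≥ 1`) with `0 < Λ(β,1) ≤ 1`,
`Λ(β,1) − λ_b(β) ≤ K · Λ(β,1)²`, `K = (b₁/b₀)(3 − log(2b₀))` — the running and bare Lüscher parameters of the one-site model agree to
second order (in fact to order `Λ⁴ log Λ`). [cite: LuscherMunster1984, §2] -/
theorem luscherLambda_sub_bareLambda_le {β : ℝ} (hβ : 1 ≤ β) (hl : 0 < luscherLambda β 1) (hl1 : luscherLambda β 1 ≤ 1) :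
    luscherLambda β 1 - bareLambda β ≤ (b1 / b0) * (3 - Real.log (2 * b0)) * luscherLambda β 1 ^ 2 := by
  have hβ0 : 0 < β := by linarith
  have hb0 : 0 < b0 := by unfold b0; positivity
  have hb1 : 0 < b1 := by unfold b1; positivity
  have hK0 : 0 ≤ b1 / b0 := (div_pos hb1 hb0).le
  set Λ : ℝ := luscherLambda β 1 with hΛ
  set l : ℝ := bareLambda β with hl_def
  have hlpos : 0 < l := bareLambda_pos' hβ0
  have hlΛ : l ≤ Λ := bareLambda_le_luscherLambda_one hβ hl
  have hl1' : l ≤ 1 := hlΛ.trans hl1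
  have hv : 0 < invRunningCoupling β 1 := BOHandover.invRunningCoupling_pos_of_luscherLambda_pos hl
  set v : ℝ := invRunningCoupling β 1 with hv_def
  have hΛ3 : Λ ^ 3 = v⁻¹ := BOHandover.luscherLambda_pow_three hv
  have hl3 : β * l ^ 3 = 2 := bareLambda_cube hβ0
  -- the deficit `δ = β/2 − v` and its bound `δ ≤ K/λ_b`
  set δ : ℝ := β / 2 - v with hδ
  have hδeq : δ = (b1 / b0) * (Real.log β - Real.log (2 * b0)) := half_sub_invRunningCoupling_one hβ0
  have hlog2b0 : Real.log (2 * b0) ≤ 0 := Real.log_nonpos (by positivity) BOHandover.two_mul_b0_le_one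
  have hlogβ : Real.log β ≤ 3 / l := log_le_three_div_bareLambda hβ0
  have hδle : δ * l ≤ (b1 / b0) * (3 - Real.log (2 * b0)) := by
    rw [hδeq]
    have h1 : Real.log β * l ≤ 3 := by
      have := mul_le_mul_of_nonneg_right hlogβ hlpos.le
      rwa [div_mul_cancel₀ _ hlpos.ne'] at this
    have h2 : -Real.log (2 * b0) * l ≤ -Real.log (2 * b0) := by
      have := mul_le_mul_of_nonneg_left hl1' (by linarith : 0 ≤ -Real.log (2 * b0))
      rwa [mul_one] at this
    have h3 : (Real.log β - Real.log (2 * b0)) * l ≤ 3 - Real.log (2 * b0) := by nlinarith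
    calc (b1 / b0) * (Real.log β - Real.log (2 * b0)) * l
        = (b1 / b0) * ((Real.log β - Real.log (2 * b0)) * l) := by ring
      _ ≤ (b1 / b0) * (3 - Real.log (2 * b0)) := mul_le_mul_of_nonneg_left h3 hK0
  -- the cubic identity `Λ³ − l³ = δ Λ³ l³`
  have hcubic : Λ ^ 3 - l ^ 3 = δ * Λ ^ 3 * l ^ 3 := by
    have hl3' : l ^ 3 = 2 / β := by
      rw [eq_div_iff hβ0.ne']; linarith
    rw [hΛ3, hl3', hδ]
    field_simp
  -- `(Λ − l) Λ² ≤ Λ³ − l³`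
  have hΛpos : 0 < Λ := hl
  have hfactor : (Λ - l) * Λ ^ 2 ≤ Λ ^ 3 - l ^ 3 := by
    have hsub : 0 ≤ Λ - l := by linarith
    nlinarith [mul_nonneg hsub (mul_nonneg hΛpos.le hlpos.le), mul_nonneg hsub (sq_nonneg l)]
  -- combine: `(Λ − l) Λ² ≤ δ Λ³ l³ = (δ l) Λ³ l² ≤ K Λ³ l² ≤ K Λ² · Λ² ≤ …`; divide by `Λ²`
  have hΛ2 : 0 < Λ ^ 2 := by positivity
  have hδl : 0 ≤ δ * l := by
    rw [hδeq]
    have : 0 ≤ Real.log β - Real.log (2 * b0) := by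
      have := Real.log_nonneg hβ; linarith
    positivity
  have hstep : (Λ - l) * Λ ^ 2 ≤ ((b1 / b0) * (3 - Real.log (2 * b0)) * Λ ^ 2) * Λ ^ 2 := by
    calc (Λ - l) * Λ ^ 2 ≤ Λ ^ 3 - l ^ 3 := hfactor
      _ = (δ * l) * (Λ * l ^ 2) * Λ ^ 2 := by rw [hcubic]; ring
      _ ≤ ((b1 / b0) * (3 - Real.log (2 * b0))) * (Λ * l ^ 2) * Λ ^ 2 := by
          apply mul_le_mul_of_nonneg_right _ hΛ2.le
          exact mul_le_mul_of_nonneg_right hδle (by positivity)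
      _ ≤ ((b1 / b0) * (3 - Real.log (2 * b0))) * Λ ^ 2 * Λ ^ 2 := by
          apply mul_le_mul_of_nonneg_right _ hΛ2.le
          apply mul_le_mul_of_nonneg_left _ anchorK_pos.le
          -- `Λ l² ≤ Λ² ⇐ l² ≤ Λ · 1`… use `l ≤ Λ` and `l ≤ 1`
          nlinarith [mul_le_mul hlΛ hl1' hlpos.le hΛpos.le]
  exact le_of_mul_le_mul_right hstep hΛ2

/-- ★ **THE SUPPORT ITEM `OneSiteWindowAnchor` (stmt-QuantumFields-23508), PROVED**: there are `C` and `lam0 > 0` such that on the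
one-site window of any depth `lam ≤ lam0`, `λ₁(β,1) ≤ e^{−(ε₁Λ − CΛ²)} λ₀(β,1)` with the RUNNING parameter `Λ = luscherLambda β 1` — the
proved one-site law `femtoGapOneSite_proof` (bare parameter) plus the label comparison `0 ≤ Λ − λ_b ≤ KΛ²`.
Constants: `C = |ε₁|·K + |C_one|`, `lam0 = min(1/2, 1/(4·max(β₀,1)))`. [cite: Luscher1983, §2] [cite: LuscherMunster1984, §2] -/
theorem oneSiteWindowAnchor_proof : Summit.QuantumFields.YangMills.Theses.FemtoCutoffLadder.OneSiteWindowAnchor := by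
  obtain ⟨C, β0, H⟩ := femtoGapOneSite_proof
  set K : ℝ := (b1 / b0) * (3 - Real.log (2 * b0)) with hK
  have hKpos : 0 < K := anchorK_pos
  set M : ℝ := max β0 1 with hM
  have hM1 : 1 ≤ M := le_max_right _ _
  have hMpos : 0 < M := by linarith
  refine ⟨|luscherEps1| * K + |C|, min (1 / 2) (1 / (4 * M)), lt_min (by norm_num) (by positivity), ?_⟩
  intro lam hlam hle β hW
  have hhalf : lam ≤ 1 / 2 := hle.trans (min_le_left _ _)
  have hlamM : lam ≤ 1 / (4 * M) := hle.trans (min_le_right _ _)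
  have hlam1 : lam ≤ 1 := by linarith
  have hβ1 : 1 ≤ β := hW.1
  have hβ0 : 0 < β := by linarith
  -- `β ≥ β₀` deep in the window
  have hβge : β0 ≤ β :=
    ((le_max_left _ _).trans (BOHandover.le_of_small_lam hM1 hlam hlam1 hlamM)).trans
      (BOHandover.beta_ge_of_window (L0 := 1) hlam hW)
  have hmain := H β hβge
  simp only [Nat.cast_one, div_one] at hmain
  -- label comparison
  set Λ : ℝ := luscherLambda β 1 with hΛ
  set l : ℝ := bareLambda β with hl_def
  have hΛpos : 0 < Λ := luscherLambda_pos_of_window hlam hW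
  have hΛ1 : Λ ≤ 1 := by have := hW.2.2; linarith
  have hlΛ : l ≤ Λ := bareLambda_le_luscherLambda_one hβ1 hΛpos
  have hlpos : 0 < l := bareLambda_pos' hβ0
  have hdiff : Λ - l ≤ K * Λ ^ 2 := luscherLambda_sub_bareLambda_le hβ1 hΛpos hΛ1
  -- exponent comparison: `ε₁Λ − C'Λ² ≤ ε₁ l − C l²`
  have hexp : -(luscherEps1 * l - C * l ^ 2) ≤ -(zLower (|luscherEps1| * K + |C|) β 1) := by
    have hz : zLower (|luscherEps1| * K + |C|) β 1 = luscherEps1 * Λ - (|luscherEps1| * K + |C|) * Λ ^ 2 := rfl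
    rw [hz]
    have h1 : luscherEps1 * (Λ - l) ≤ |luscherEps1| * (K * Λ ^ 2) := by
      calc luscherEps1 * (Λ - l) ≤ |luscherEps1| * (Λ - l) :=
            mul_le_mul_of_nonneg_right (le_abs_self _) (by linarith)
        _ ≤ |luscherEps1| * (K * Λ ^ 2) := mul_le_mul_of_nonneg_left hdiff (abs_nonneg _)
    have h2 : C * l ^ 2 ≤ |C| * Λ ^ 2 := by
      calc C * l ^ 2 ≤ |C| * l ^ 2 := mul_le_mul_of_nonneg_right (le_abs_self _) (sq_nonneg _)
        _ ≤ |C| * Λ ^ 2 := mul_le_mul_of_nonneg_left (pow_le_pow_left₀ hlpos.le hlΛ 2) (abs_nonneg _)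
    nlinarith
  exact hmain.trans (mul_le_mul_of_nonneg_right (Real.exp_le_exp.mpr hexp) (topValue_nonneg su2Rep 1 β))

end Summit.QuantumFields.YangMills.Theorems.FemtoCutoffLadder

end
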